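import Summits.QuantumFields.YangMills.Theorems.BalabanUVNodesN15PerCubeGreenAdjointSummandRows
import HarnessLib

/-!
# N15 = NE2, road (c) — PROGRAMME (PC), (PC-E-K) ENTRY 2 «`G′(U)∇*_U` of [B9] (3.42), TWO GRIDS»: THE BUMP-SMEARED SPECIES FITS FROM THE SHARP ONES — pointwise row-sum algebra
# `χ̃′·C′ − (χ̃·C)∘π = (χ̃′ − χ̃∘π)·C′ + (χ̃∘π)·(χ′·C′ − (χ·C)∘π)` on the box (dag-n15-c g37, n15-c∕431a)

Cell `pub-ymgap`, seat `pub-ymgap-dag-n15-c` (generation g37; R134 (a), s1; HUMAN RULING D-0062).  `bears_on: R4∕N15 · K3⁸ SpineGivenEndpointR13SepCoPHV (stmt-QuantumFields-27366)`;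
filed `--kind proof --supports stmt-QuantumFields-27366 --as helper` — COUNT-NEUTRAL.  Theorems only ([folklore] row-sum bookkeeping); 0 `def`, 0 `sorry`.  Imports n15-c∕430a only for the
ambient namespace and Mathlib.  Nothing in the tree is modified; nothing restated.

WHY.  The two-grid η-defect of entry 2 (n15-c∕430 `uN_idef_scAdjGreen_tr`) displays the species fits across King's pairing SMEARED BY THE BUMP `χ̃_k` (n15-c∕427's `hfitCt`, `hfitAt`:
`Σ_j |(χ̃′_k(x′)•C′(x′) − χ̃_k(πx′)•C(πx′))_{ij}| ≤ o_C`), whereas the pairing files of entries 0∕1 (n15-c∕37x, `…CovariantTwoGridSpeciesFitA∕C`) produce the fits smeared by the SHARP cut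
`χ_k` (n15-c∕340's `hfitC`, `hfitA`, letter `o_V`).  Since both bumps live inside the box where `χ′_k = χ_k∘π = 1`, the smeared fit is the sharp fit plus the bump's own fit times the
coefficient row: `o_C := o_χ·r_V + o_V` — pure algebra, recorded here once for every coefficient family (values `C`, first-order coefficients `A_j`).

WHAT.  ★ `rowSum_smul_sub_smul_le_of_sharp`: for maps `π : X′ → X`, weights `b′, χ′ : X′ → ℝ`, `b, χ : X → ℝ` with `|b| ≤ 1`, `|b′ − b∘π| ≤ o_χ`, `b′ ≠ 0 ⟹ χ′ = 1`,
`b∘π ≠ 0 ⟹ χ′ = 1 ∧ χ∘π = 1`, coefficient rows `χ′ ≠ 0 ⟹ Σ_j|C′_{ij}| ≤ r_V` and the sharp fit `Σ_j|(χ′•C′ − (χ•C)∘π)_{ij}| ≤ o_V`: the smeared fit `Σ_j|(b′•C′ − (b•C)∘π)_{ij}| ≤ o_χ·r_V + o_V`.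

HONEST FRAMING ∕ LIMITS.  Finite-sum algebra; no analytic content; nothing of [B5]∕[B6]∕[B9] asserted ((3.51)–(3.53) p.400, (3.62)–(3.65) pp.402–403 = SHAPES of the objects the letters
refer to).  NE2⁺ NOT PRINTED, NOT proved; N15 of record untouched (DISCHARGED AS CONSUMED, p687738); K3⁸ OPEN; counts of record UNMOVED (typed 28∕28 · discharged 8∕27); one finite 𝕋⁴ at
fixed ε per index — NOT infinite volume, NOT OS on ℝ⁴, NOT a mass gap, NOT Clay.  Restate-immune (no Theses import).
-/

noncomputable section

open scoped BigOperators Matrix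

namespace Summit.QuantumFields.YangMills.BalabanUVNodes.N15.Gluing

/-! ## The smeared fit from the sharp fit -/

section Smear

variable {X X' κ : Type} [Fintype κ]

/-- ★ **THE BUMP-SMEARED FIT FROM THE SHARP FIT**: `Σ_j |(b′(x′)•C′(x′) − b(πx′)•C(πx′))_{ij}| ≤ o_χ·r_V + o_V` when `|b| ≤ 1`, `|b′ − b∘π| ≤ o_χ`, both weights live where the sharp
cuts are `1` (`b′ ≠ 0 ⟹ χ′ = 1`, `b∘π ≠ 0 ⟹ χ′ = 1 ∧ χ∘π = 1`), the coefficient rows on `{χ′ ≠ 0}` are `≤ r_V`, and the sharp fit is `Σ_j |(χ′•C′ − (χ•C)∘π)_{ij}| ≤ o_V`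
(n15-c∕427's `hfitCt`∕`hfitAt` from n15-c∕340's `hfitC`∕`hfitA` and the bump fit). [cite: Balaban1985BackgroundPropagators, (3.51)–(3.53) p.400, (3.62)–(3.65) pp.402–403 (shapes); Balaban1985Averaging, (125) p.36 (the pairing: shape)] -/
theorem rowSum_smul_sub_smul_le_of_sharp (π : X' → X) (b' χ' : X' → ℝ) (b χ : X → ℝ) (C' : X' → Matrix κ κ ℝ) (C : X → Matrix κ κ ℝ) {oχ rV oV : ℝ}
    (hoχ : 0 ≤ oχ) (hrV : 0 ≤ rV) (hoV : 0 ≤ oV) (hb1 : ∀ x, |b x| ≤ 1) (hfit : ∀ x', |b' x' - b (π x')| ≤ oχ) (hsupp' : ∀ x', b' x' ≠ 0 → χ' x' = 1)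
    (hsupp : ∀ x', b (π x') ≠ 0 → χ' x' = 1 ∧ χ (π x') = 1) (hC' : ∀ x', χ' x' ≠ 0 → ∀ i, ∑ j, |C' x' i j| ≤ rV)
    (hsharp : ∀ x' i, ∑ j, |(χ' x' • C' x' - χ (π x') • C (π x')) i j| ≤ oV) (x' : X') (i : κ) :
    ∑ j, |(b' x' • C' x' - b (π x') • C (π x')) i j| ≤ oχ * rV + oV := by
  by_cases h0 : b' x' = 0 ∧ b (π x') = 0
  · have hz : ∀ j, |(b' x' • C' x' - b (π x') • C (π x')) i j| = 0 := fun j => by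
      rw [h0.1, h0.2, zero_smul, zero_smul, sub_self, Matrix.zero_apply, abs_zero]
    rw [Finset.sum_congr rfl fun j _ => hz j, Finset.sum_const_zero]; positivity
  · -- on the box: `χ′(x′) = 1`, and if `b(πx′) ≠ 0` also `χ(πx′) = 1`
    have hχ'1 : χ' x' = 1 := by
      by_cases h1 : b' x' = 0
      · exact (hsupp x' (fun h2 => h0 ⟨h1, h2⟩)).1
      · exact hsupp' x' h1
    -- the decomposition `b′C′ − (bC)∘π = (b′ − b∘π)•C′ + (b∘π)•(χ′C′ − (χC)∘π)`
    have hdec : ∀ j, (b' x' • C' x' - b (π x') • C (π x')) i j = (b' x' - b (π x')) * C' x' i j + b (π x') * (χ' x' • C' x' - χ (π x') • C (π x')) i j := fun j => by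
      by_cases h2 : b (π x') = 0
      · simp only [h2, zero_smul, sub_zero, Matrix.smul_apply, smul_eq_mul, zero_mul, add_zero]
      · have hχ1 : χ (π x') = 1 := (hsupp x' h2).2
        simp only [Matrix.sub_apply, Matrix.smul_apply, smul_eq_mul, hχ'1, hχ1, one_mul]; ring
    calc ∑ j, |(b' x' • C' x' - b (π x') • C (π x')) i j| = ∑ j, |(b' x' - b (π x')) * C' x' i j + b (π x') * (χ' x' • C' x' - χ (π x') • C (π x')) i j| :=
          Finset.sum_congr rfl fun j _ => by rw [hdec j]
      _ ≤ ∑ j, (|b' x' - b (π x')| * |C' x' i j| + |b (π x')| * |(χ' x' • C' x' - χ (π x') • C (π x')) i j|) :=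
          Finset.sum_le_sum fun j _ => (abs_add_le _ _).trans (by rw [abs_mul, abs_mul])
      _ = |b' x' - b (π x')| * ∑ j, |C' x' i j| + |b (π x')| * ∑ j, |(χ' x' • C' x' - χ (π x') • C (π x')) i j| := by
          rw [Finset.sum_add_distrib, Finset.mul_sum, Finset.mul_sum]
      _ ≤ oχ * rV + 1 * oV := add_le_add (mul_le_mul (hfit x') (hC' x' (by rw [hχ'1]; exact one_ne_zero) i) (Finset.sum_nonneg fun j _ => abs_nonneg _) hoχ)
          (mul_le_mul (hb1 _) (hsharp x' i) (Finset.sum_nonneg fun j _ => abs_nonneg _) zero_le_one)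
      _ = oχ * rV + oV := by rw [one_mul]

end Smear

/-! ## The shifted fit from the unshifted fit and a one-step difference, through King's pairing map -/

section Shift

variable {X X' κ : Type} [Fintype κ]

/-- ★ **THE SHIFTED FIT ACROSS THE PAIRING**: if `Σ_j|(f′(y′) − f(πy′))_{ij}| ≤ o` everywhere, the coarse one-step differences are `Σ_j|(f(ez) − f(z))_{ij}| ≤ s`, and the pairing map
crosses a coarse step at most once (`π(e′y′) = πy′` or `π(e′y′) = e(πy′)` — dag-n15-c `kingPr_add_unitVec` for King's block-corner projection and the site shifts), then
`Σ_j|(f′(e′y′) − f(e(πy′)))_{ij}| ≤ o + s` (n15-c∕427's SHIFTED smeared fits `hfAsh1`∕`hfAsh2` from the unshifted ones; the matrix-row edition of n15-c∕413 `abs_shift_fit_of_cross`).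
[cite: Balaban1985BackgroundPropagators, Thm 3.14 pp.426–427 (two-grid difference: template); King1986, p.664 (block projection: shape)] -/
theorem rowSum_shift_fit_of_cross (π : X' → X) (e : X → X) (e' : X' → X') (f : X → Matrix κ κ ℝ) (f' : X' → Matrix κ κ ℝ) {o s : ℝ} (hs : 0 ≤ s)
    (hfit : ∀ y' i, ∑ j, |(f' y' - f (π y')) i j| ≤ o) (hstep : ∀ z i, ∑ j, |(f (e z) - f z) i j| ≤ s) (hcross : ∀ y', π (e' y') = π y' ∨ π (e' y') = e (π y')) (y' : X') (i : κ) :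
    ∑ j, |(f' (e' y') - f (e (π y'))) i j| ≤ o + s := by
  have hsplit : ∀ j, (f' (e' y') - f (e (π y'))) i j = (f' (e' y') - f (π (e' y'))) i j + (f (π (e' y')) - f (e (π y'))) i j := fun j => by
    simp only [Matrix.sub_apply]; ring
  have h2 : ∑ j, |(f (π (e' y')) - f (e (π y'))) i j| ≤ s := by
    rcases hcross y' with h | h
    · rw [h]
      calc ∑ j, |(f (π y') - f (e (π y'))) i j| = ∑ j, |(f (e (π y')) - f (π y')) i j| := Finset.sum_congr rfl fun j _ => by rw [Matrix.sub_apply, Matrix.sub_apply, abs_sub_comm]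
        _ ≤ s := hstep (π y') i
    · rw [h]
      have hz : ∀ j, |(f (e (π y')) - f (e (π y'))) i j| = 0 := fun j => by rw [sub_self, Matrix.zero_apply, abs_zero]
      rw [Finset.sum_congr rfl fun j _ => hz j, Finset.sum_const_zero]; exact hs
  calc ∑ j, |(f' (e' y') - f (e (π y'))) i j| = ∑ j, |(f' (e' y') - f (π (e' y'))) i j + (f (π (e' y')) - f (e (π y'))) i j| := Finset.sum_congr rfl fun j _ => by rw [hsplit j]
    _ ≤ ∑ j, (|(f' (e' y') - f (π (e' y'))) i j| + |(f (π (e' y')) - f (e (π y'))) i j|) := Finset.sum_le_sum fun j _ => abs_add_le _ _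
    _ ≤ o + s := by rw [Finset.sum_add_distrib]; exact add_le_add (hfit (e' y') i) h2

end Shift

/-! ## The cut defect behind a smooth cut on the right: `𝔇(A′M_{χ̃′}, AM_{χ̃})` from `𝔇(A′M_{χ′}, AM_{χ})`, the fine row and the bump fit -/

section RightCut

open Literature.MathematicalPhysics.QuantumFieldTheory.Balaban1983to89
open Literature.MathematicalPhysics.QuantumFieldTheory.Balaban1983to89.B11SectG (BlockNorm HasMaj)
open Literature.MathematicalPhysics.QuantumFieldTheory.Balaban1983to89.T4EtaRateDefect (idef idef_comp)
open Literature.MathematicalPhysics.QuantumFieldTheory.Balaban1983to89.T4EtaRateCoeffDefect (pull diagK diagK_nonneg hasMaj_mulOp hasMaj_idef_mulOp)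
open Literature.MathematicalPhysics.QuantumFieldTheory.Balaban1983to89.B6Prop26Gluing (mulOp)

variable {Y Y' : Type} [Fintype Y] [Fintype Y'] {g : B6.Geometry} (blk : Y → g.Site) (π : Y' → Y)

/-- ★★ **THE CUT BASE DEFECT BEHIND THE SMOOTH CUT** (n15-c∕427's `hDNVc` from n15-c∕340's `hDNV`): if `M_χM_{χ̃} = M_{χ̃}` at both grids (the bump lives in the box), `|χ̃| ≤ 1`,
`|χ̃′ − χ̃∘π| ≤ o_χ`, the fine cut operator has the row `A′M_{χ′} ≤ R·e^{−δd}` and the sharp defect is `𝔇(A′M_{χ′}, AM_χ) ≤ o_N·e^{−δd}`, then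
`𝔇(A′M_{χ̃′}, AM_{χ̃}) = (A′M_{χ′})∘𝔇(M_{χ̃′}, M_{χ̃}) + 𝔇(A′M_{χ′}, AM_χ)∘M_{χ̃} ≤ (o_N + R·o_χ)·e^{−δd}` (lit `idef_comp`, `hasMaj_idef_mulOp`).
[cite: Balaban1985BackgroundPropagators, Thm 3.14 pp.426–427 (two-grid difference: template), (3.62)–(3.65) pp.402–403 (nested cut-offs: shape)] -/
theorem hasMaj_idef_comp_smoothCut_right {A : (Y → ℝ) →ₗ[ℝ] (Y → ℝ)} {A' : (Y' → ℝ) →ₗ[ℝ] (Y' → ℝ)} {χ χt : Y → ℝ} {χ' χt' : Y' → ℝ} {R oN oχ δ : ℝ}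
    (hR : 0 ≤ R) (hoN : 0 ≤ oN) (hoχ : 0 ≤ oχ) (hχt : ∀ y, |χt y| ≤ 1) (hfit : ∀ y', |χt' y' - χt (π y')| ≤ oχ)
    (hχ : mulOp χ ∘ₗ mulOp χt = mulOp χt) (hχ' : mulOp χ' ∘ₗ mulOp χt' = mulOp χt')
    (hrow' : HasMaj (BlockNorm.ofBlocks g (blk ∘ π)) (BlockNorm.ofBlocks g (blk ∘ π)) (A' ∘ₗ mulOp χ') (fun y y' => R * Real.exp (-(δ * g.dist y y'))))
    (hD : HasMaj (BlockNorm.ofBlocks g blk) (BlockNorm.ofBlocks g (blk ∘ π)) (idef (pull π) (pull π) (A' ∘ₗ mulOp χ') (A ∘ₗ mulOp χ)) (fun y y' => oN * Real.exp (-(δ * g.dist y y')))) :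
    HasMaj (BlockNorm.ofBlocks g blk) (BlockNorm.ofBlocks g (blk ∘ π)) (idef (pull π) (pull π) (A' ∘ₗ mulOp χt') (A ∘ₗ mulOp χt))
      (fun y y' => (oN + R * oχ) * Real.exp (-(δ * g.dist y y'))) := by
  have e1 : A ∘ₗ mulOp χt = (A ∘ₗ mulOp χ) ∘ₗ mulOp χt := by rw [LinearMap.comp_assoc, hχ]
  have e2 : A' ∘ₗ mulOp χt' = (A' ∘ₗ mulOp χ') ∘ₗ mulOp χt' := by rw [LinearMap.comp_assoc, hχ']
  rw [e1, e2, idef_comp (pull π) (pull π) (pull π) (A' ∘ₗ mulOp χ') (mulOp χt') (A ∘ₗ mulOp χ) (mulOp χt)]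
  have hd := hasMaj_idef_mulOp (g := g) blk π (o := fun _ => oχ) (fun _ => hoχ) hfit
  have t1 := hasMaj_comp_diag (blk₂ := blk ∘ π) (fun y y' => mul_nonneg hR (Real.exp_nonneg _)) hrow' hd
  have t2 := hasMaj_comp_diag (blk₂ := blk) (fun y y' => mul_nonneg hoN (Real.exp_nonneg _)) hD (hasMaj_mulOp (g := g) blk (m := fun _ => (1 : ℝ)) (fun _ => zero_le_one) hχt)
  refine (t1.add t2).mono fun y y' => le_of_eq ?_
  ring

end RightCut

end Summit.QuantumFields.YangMills.BalabanUVNodes.N15.Gluing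

end
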